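import Literature.NumberTheory.LFunctions.WeilGroundStateRealZerosProofs
import Literature.NumberTheory.LFunctions.WeilExplicitContinuous
import HarnessLib

/-!
# PF-persistence, fake family F5: bounded dials beyond the cutoff are negative (F5-A, PROVED)

MECHANISM/RIGIDITY CAMPAIGN; NO RH CLAIMS (pub-rhpf, seat fake-5; `FAKES.md §5.2`, ruling A16(a)).

For a prime `p` and a dial `K ≥ 0` on the explicit-formula weights of ALL powers of `p` (`K = 0` is
the prime-deletion twin `T_p`), let `δ := |1 - K| (log p)/√p`, `0 < b`, `2b < log p`, and let `g₁`
be a Weil test function supported in `[-b, b]` with `Re Q_ζ(g₁) ≤ ε‖g₁‖₂²`.  The CENTRED twin test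
is `g := τ_{-log p/2} g₁ - σ·τ_{+log p/2} g₁`, `σ := sign (1 - K)`, supported in the window
`a_p := (log p)/2 + b`.

* `tailDialRayleighBound`: IF `ζ` is Weil-positive on the window `a_p` THEN
  `Re Q_{p,K}(g) ≤ (2ε - δ)·2‖g₁‖₂²`;
* `tailDialNegativeOrZetaNotPositive` (RH-free dichotomy): if `2ε < δ` and `‖g₁‖₂ > 0` then
  `¬ WeilPositivityOn a_p ∨ Re Q_{p,K}(g) < 0`; the instance `K = 0` is
  `primeDeletion_negative_or_zeta_not_positive`.

Proof: `Q(h)` depends on `h` only through `A_h = h ⋆ h̃`, which is translation invariant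
(`weilQuadratic_translate`); `Q_ζ` and `Q_{p,K}` differ by
`(1-K)(log p)p^{-1/2}(A_h(log p) + A_h(-log p))` when `A_h` vanishes outside `|u| ≤ R < 2 log p`
(`weilPrimeTerm_sub_dialPrimeTerm`: `n = p^k`, `k ≥ 2`, is killed by the support); for the twin,
`A_g(±log p) = -σ‖g₁‖₂²` by disjointness of supports (`weilConv_weilReflect_twin_two_mul`); and the
parallelogram identity for `Re Q` (tree: `ConnesVanSuijlekom.re_weilQuadratic_add_real_mul`) with
`Re Q_ζ(u + σv) ≥ 0` gives `Re Q_ζ(u - σv) ≤ 2Re Q(u) + 2σ²Re Q(v) ≤ 4ε‖g₁‖₂²`.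
-/

set_option linter.dupNamespace false

noncomputable section
open scoped ArithmeticFunction ComplexConjugate
open Set MeasureTheory Complex Literature.NumberTheory.LFunctions

namespace Summit.RiemannHypothesis.RiemannHypothesis.Theorems.PfPersistenceF5TailTwins

/-- The prime term with the weights of all powers of the prime `p` multiplied by `K`
(`K = 0`: `p` deleted; `K = 1`: `ζ`). -/
def dialPrimeTerm (p : ℕ) (K : ℝ) (g : ℝ → ℂ) : ℂ :=
  ∑' n : ℕ, ((if p ∣ n then K else 1 : ℝ) : ℂ) * (((Λ n : ℝ) : ℂ) / (Real.sqrt n : ℂ)) *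
    (g (Real.log n) + g (-Real.log n))

/-- The dialled Weil functional `polar − dialled prime term + arch` (same dressing as `ζ`). -/
def dialFunctional (p : ℕ) (K : ℝ) (g : ℝ → ℂ) : ℂ :=
  weilPolarTerm g - dialPrimeTerm p K g + weilArchTerm g

/-- The dialled quadratic form `Q_{p,K}(g) := W_{p,K}(g ⋆ g̃)`. -/
def dialQuadratic (p : ℕ) (K : ℝ) (g : ℝ → ℂ) : ℂ :=
  dialFunctional p K (weilConv g (weilReflect g))

/-- Translation `(τ_c g)(x) = g(x - c)` (the tree's `weilTranslate g c`). -/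
def translate (c : ℝ) (g : ℝ → ℂ) : ℝ → ℂ := fun x ↦ g (x - c)

/-- The twin combination `τ_{-c} g - σ τ_{c} g`. -/
def twin (c σ : ℝ) (g : ℝ → ℂ) : ℝ → ℂ :=
  fun x ↦ translate (-c) g x - (σ : ℂ) * translate c g x

/-- The F5-A test function: two copies of `g₁` centred at `∓ (log p)/2` with relative sign `-σ`,
`σ = sign (1 - K)`. -/
def tailTwinTest (p : ℕ) (K : ℝ) (g₁ : ℝ → ℂ) : ℝ → ℂ :=
  twin (Real.log p / 2) (SignType.sign (1 - K) : ℝ) g₁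

/-- THEOREM F5-A, dichotomy form (a `Prop`; proved below): bounded dials beyond the cutoff are
negative a bounded distance above their threshold, or `ζ` already fails Weil positivity there. -/
def TailDialNegativeOrZetaNotPositive : Prop :=
  ∀ (p : ℕ), p.Prime → ∀ (K b ε : ℝ), 0 ≤ K → 0 < b → 2 * b < Real.log p →
    ∀ g₁ : ℝ → ℂ, IsWeilTest g₁ → tsupport g₁ ⊆ Icc (-b) b →
      (weilQuadratic g₁).re ≤ ε * ∫ x, ‖g₁ x‖ ^ 2 → 0 < ∫ x, ‖g₁ x‖ ^ 2 →
      2 * ε < |1 - K| * Real.log p / Real.sqrt p →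
        ¬ WeilPositivityOn (Real.log p / 2 + b) ∨
          (dialQuadratic p K (tailTwinTest p K g₁)).re < 0

/-- THEOREM F5-A, quantitative form (a `Prop`; proved below). -/
def TailDialRayleighBound : Prop :=
  ∀ (p : ℕ), p.Prime → ∀ (K b ε : ℝ), 0 ≤ K → 0 < b → 2 * b < Real.log p →
    WeilPositivityOn (Real.log p / 2 + b) →
    ∀ g₁ : ℝ → ℂ, IsWeilTest g₁ → tsupport g₁ ⊆ Icc (-b) b →
      (weilQuadratic g₁).re ≤ ε * ∫ x, ‖g₁ x‖ ^ 2 →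
        (dialQuadratic p K (tailTwinTest p K g₁)).re ≤
          (2 * ε - |1 - K| * Real.log p / Real.sqrt p) * (2 * ∫ x, ‖g₁ x‖ ^ 2)

/-- The quantitative form implies the dichotomy (logic + arithmetic). -/
theorem tailDialNegativeOrZetaNotPositive_of_bound (h : TailDialRayleighBound) :
    TailDialNegativeOrZetaNotPositive := by
  intro p hp K b ε hK hb hb2 g₁ hg hsupp hq hpos hδ
  by_cases hW : WeilPositivityOn (Real.log p / 2 + b)
  · exact Or.inr (lt_of_le_of_lt (h p hp K b ε hK hb hb2 hW g₁ hg hsupp hq)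
      (mul_neg_of_neg_of_pos (by linarith) (by linarith)))
  · exact Or.inl hW

/-! ## Supports and translates -/

variable {g : ℝ → ℂ} {b c : ℝ}

/-- Translates of Weil test functions are Weil test functions. -/
theorem isWeilTest_translate (hg : IsWeilTest g) (c : ℝ) : IsWeilTest (translate c g) :=
  hg.weilTranslate c

/-- Support of a translate. -/
theorem tsupport_translate_subset (hs : tsupport g ⊆ Icc (-b) b) (c : ℝ) :
    tsupport (translate c g) ⊆ Icc (-b + c) (b + c) := by
  refine closure_minimal (fun x hx ↦ ?_) isClosed_Icc
  have hx' : g (x - c) ≠ 0 := by simpa [translate, Function.mem_support] using hx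
  have hmem := hs (subset_tsupport _ hx')
  simp only [mem_Icc] at hmem ⊢
  constructor <;> linarith [hmem.1, hmem.2]

/-- Support of `u + t·v` for two functions supported in a closed set. -/
theorem tsupport_add_mul_subset {u v : ℝ → ℂ} {s : Set ℝ} (hsc : IsClosed s)
    (hu : tsupport u ⊆ s) (hv : tsupport v ⊆ s) (t : ℂ) :
    tsupport (u + fun x ↦ t * v x) ⊆ s := by
  refine closure_minimal (fun x hx ↦ ?_) hsc
  rw [Function.mem_support] at hx
  by_contra hxs
  have h1 : u x = 0 := image_eq_zero_of_notMem_tsupport (fun h ↦ hxs (hu h))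
  have h2 : v x = 0 := image_eq_zero_of_notMem_tsupport (fun h ↦ hxs (hv h))
  exact hx (by simp [h1, h2])

/-- The twin as `u + (-σ)·v`. -/
theorem twin_eq_add (c σ : ℝ) (g : ℝ → ℂ) :
    twin c σ g = translate (-c) g + fun x ↦ ((-σ : ℝ) : ℂ) * translate c g x := by
  funext x; simp only [twin, Pi.add_apply]; push_cast; ring

/-- The twin of a Weil test function is a Weil test function. -/
theorem isWeilTest_twin (hg : IsWeilTest g) (c σ : ℝ) : IsWeilTest (twin c σ g) :=
  twin_eq_add c σ g ▸ (isWeilTest_translate hg _).add ((isWeilTest_translate hg _).const_mul _)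

/-- Support of the twin. -/
theorem tsupport_twin_subset (hs : tsupport g ⊆ Icc (-b) b) (hc : 0 ≤ c) (σ : ℝ) :
    tsupport (twin c σ g) ⊆ Icc (-(c + b)) (c + b) := by
  rw [twin_eq_add]
  refine tsupport_add_mul_subset isClosed_Icc ?_ ?_ _
  · exact (tsupport_translate_subset hs (-c)).trans (Icc_subset_Icc (by linarith) (by linarith))
  · exact (tsupport_translate_subset hs c).trans (Icc_subset_Icc (by linarith) (by linarith))

/-- `g(y) conj g(y') = 0` when `|y - y'| > 2b ≥ diam (supp g)`. -/
theorem mul_conj_eq_zero_of_shift (hs : tsupport g ⊆ Icc (-b) b) {y y' : ℝ}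
    (h : 2 * b < |y - y'|) : g y * conj (g y') = 0 := by
  by_cases hy : g y = 0
  · simp [hy]
  · have hy1 := hs (subset_tsupport _ hy)
    have hy' : y' ∉ Icc (-b) b := by
      intro h'
      simp only [mem_Icc] at hy1 h'
      have : |y - y'| ≤ 2 * b := abs_le.2 ⟨by linarith, by linarith⟩
      linarith
    simp [eq_zero_of_tsupport_subset hs hy']

/-! ## Translation invariance of the autocorrelation -/

/-- `A_{τ_c g} = A_g`. -/
theorem weilConv_weilReflect_translate (c : ℝ) (g : ℝ → ℂ) :
    weilConv (translate c g) (weilReflect (translate c g)) = weilConv g (weilReflect g) := by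
  funext x
  rw [weilConv_apply, weilConv_apply, ← integral_sub_right_eq_self (μ := (volume : Measure ℝ))
    (fun u : ℝ ↦ g u * weilReflect g (x - u)) c]
  congr 1 with u
  simp only [translate, weilReflect, show -(x - u) - c = -(x - (u - c)) by ring]

/-- `Q(τ_c g) = Q(g)`. -/
theorem weilQuadratic_translate (c : ℝ) (g : ℝ → ℂ) :
    weilQuadratic (translate c g) = weilQuadratic g :=
  congrArg weilFunctional (weilConv_weilReflect_translate c g)

/-! ## The autocorrelation of the twin at `±2c` -/

/-- Pointwise: `twin(u)·conj twin(u - 2c) = -σ‖g(u - c)‖²` (three cross terms vanish by support). -/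
theorem twin_mul_conj_twin_sub (hs : tsupport g ⊆ Icc (-b) b) (hb : 0 < b) (hc : b < c)
    (σ : ℝ) (u : ℝ) :
    twin c σ g u * conj (twin c σ g (u - 2 * c)) = -(σ : ℂ) * ((‖g (u - c)‖ ^ 2 : ℝ) : ℂ) := by
  have e1 : twin c σ g u = g (u + c) - σ * g (u - c) := by
    simp only [twin, translate, sub_neg_eq_add]
  have e2 : twin c σ g (u - 2 * c) = g (u - c) - σ * g (u - 3 * c) := by
    simp only [twin, translate]
    rw [show u - 2 * c - -c = u - c by ring, show u - 2 * c - c = u - 3 * c by ring]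
  have h1 : g (u + c) * conj (g (u - c)) = 0 := mul_conj_eq_zero_of_shift hs
    (by rw [show u + c - (u - c) = 2 * c by ring, abs_of_pos (by linarith)]; linarith)
  have h2 : g (u + c) * conj (g (u - 3 * c)) = 0 := mul_conj_eq_zero_of_shift hs
    (by rw [show u + c - (u - 3 * c) = 4 * c by ring, abs_of_pos (by linarith)]; linarith)
  have h3 : g (u - c) * conj (g (u - 3 * c)) = 0 := mul_conj_eq_zero_of_shift hs
    (by rw [show u - c - (u - 3 * c) = 2 * c by ring, abs_of_pos (by linarith)]; linarith)
  have h4 : g (u - c) * conj (g (u - c)) = ((‖g (u - c)‖ ^ 2 : ℝ) : ℂ) := by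
    rw [Complex.mul_conj, Complex.normSq_eq_norm_sq]
  rw [e1, e2, map_sub, map_mul, Complex.conj_ofReal]
  calc (g (u + c) - (σ : ℂ) * g (u - c)) * (conj (g (u - c)) - (σ : ℂ) * conj (g (u - 3 * c)))
      = g (u + c) * conj (g (u - c)) - (σ : ℂ) * (g (u + c) * conj (g (u - 3 * c)))
          - (σ : ℂ) * (g (u - c) * conj (g (u - c)))
          + (σ : ℂ) ^ 2 * (g (u - c) * conj (g (u - 3 * c))) := by ring
    _ = -(σ : ℂ) * ((‖g (u - c)‖ ^ 2 : ℝ) : ℂ) := by rw [h1, h2, h3, h4]; ring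

/-- Pointwise, mirrored: `twin(u)·conj twin(u + 2c) = -σ‖g(u + c)‖²`. -/
theorem twin_mul_conj_twin_add (hs : tsupport g ⊆ Icc (-b) b) (hb : 0 < b) (hc : b < c)
    (σ : ℝ) (u : ℝ) :
    twin c σ g u * conj (twin c σ g (u + 2 * c)) = -(σ : ℂ) * ((‖g (u + c)‖ ^ 2 : ℝ) : ℂ) := by
  have h := twin_mul_conj_twin_sub hs hb hc σ (u + 2 * c)
  rw [show u + 2 * c - 2 * c = u by ring, show u + 2 * c - c = u + c by ring] at h
  have h' := congrArg conj h
  rw [map_mul, Complex.conj_conj, map_mul, map_neg, Complex.conj_ofReal, Complex.conj_ofReal] at h'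
  rw [mul_comm]; exact h'

/-- `A_g(2c) = -σ‖g₁‖₂²` for the twin. -/
theorem weilConv_weilReflect_twin_two_mul (hs : tsupport g ⊆ Icc (-b) b) (hb : 0 < b) (hc : b < c)
    (σ : ℝ) :
    weilConv (twin c σ g) (weilReflect (twin c σ g)) (2 * c) =
      -(σ : ℂ) * ((∫ t, ‖g t‖ ^ 2 : ℝ) : ℂ) := by
  rw [weilConv_apply]
  have hpt : (fun u ↦ twin c σ g u * weilReflect (twin c σ g) (2 * c - u)) =
      fun u ↦ -(σ : ℂ) * ((‖g (u - c)‖ ^ 2 : ℝ) : ℂ) := by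
    funext u
    simp only [weilReflect]
    rw [show -(2 * c - u) = u - 2 * c by ring]
    exact twin_mul_conj_twin_sub hs hb hc σ u
  rw [hpt, integral_const_mul, integral_complex_ofReal,
    integral_sub_right_eq_self (μ := (volume : Measure ℝ)) (fun t : ℝ ↦ ‖g t‖ ^ 2) c]

/-- `A_g(-2c) = -σ‖g₁‖₂²` for the twin. -/
theorem weilConv_weilReflect_twin_neg_two_mul (hs : tsupport g ⊆ Icc (-b) b) (hb : 0 < b)
    (hc : b < c) (σ : ℝ) :
    weilConv (twin c σ g) (weilReflect (twin c σ g)) (-(2 * c)) =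
      -(σ : ℂ) * ((∫ t, ‖g t‖ ^ 2 : ℝ) : ℂ) := by
  rw [weilConv_apply]
  have hpt : (fun u ↦ twin c σ g u * weilReflect (twin c σ g) (-(2 * c) - u)) =
      fun u ↦ -(σ : ℂ) * ((‖g (u + c)‖ ^ 2 : ℝ) : ℂ) := by
    funext u
    simp only [weilReflect]
    rw [show -(-(2 * c) - u) = u + 2 * c by ring]
    exact twin_mul_conj_twin_add hs hb hc σ u
  rw [hpt, integral_const_mul, integral_complex_ofReal,
    integral_add_right_eq_self (μ := (volume : Measure ℝ)) (fun t : ℝ ↦ ‖g t‖ ^ 2) c]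

/-! ## The dialled prime term differs from `ζ`'s by the single prime `p` -/

/-- The dialled prime term as a finite sum when the kernel vanishes for `|u| > R`. -/
theorem dialPrimeTerm_eq_sum (p : ℕ) (K : ℝ) {f : ℝ → ℂ} {R : ℝ}
    (hf : ∀ u : ℝ, R < |u| → f u = 0) :
    dialPrimeTerm p K f = ∑ n ∈ Finset.range ⌈Real.exp (R + 1)⌉₊,
      ((if p ∣ n then K else 1 : ℝ) : ℂ) * (((Λ n : ℝ) : ℂ) / (Real.sqrt n : ℂ)) *
        (f (Real.log n) + f (-Real.log n)) := by
  unfold dialPrimeTerm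
  refine tsum_eq_sum fun n hn ↦ ?_
  rw [Finset.mem_range, not_lt] at hn
  have hn' : Real.exp (R + 1) ≤ n := (Nat.le_ceil _).trans (by exact_mod_cast hn)
  have hpos : (0 : ℝ) < n := (Real.exp_pos _).trans_le hn'
  have hlog : R + 1 ≤ Real.log n := by rwa [Real.le_log_iff_exp_le hpos]
  have h1 : R < |Real.log n| := lt_of_lt_of_le (by linarith) (le_abs_self _)
  rw [hf _ h1, hf _ (by rwa [abs_neg]), add_zero, mul_zero]

/-- If `f` vanishes for `|u| > R` with `R < 2 log p`, the `ζ` prime term minus the dialled one is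
the single term `(1 - K)(log p)p^{-1/2}(f(log p) + f(-log p))`. -/
theorem weilPrimeTerm_sub_dialPrimeTerm {p : ℕ} (hp : p.Prime) (K : ℝ) {f : ℝ → ℂ} {R : ℝ}
    (hf : ∀ u : ℝ, R < |u| → f u = 0) (hR : R < 2 * Real.log p) :
    weilPrimeTerm f - dialPrimeTerm p K f =
      (((1 - K) * (Real.log p / Real.sqrt p) : ℝ) : ℂ) * (f (Real.log p) + f (-Real.log p)) := by
  have hp1 : (1 : ℝ) < p := by exact_mod_cast hp.one_lt
  have hp0 : (0 : ℝ) < p := by linarith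
  have hvan : ∀ n : ℕ, R < Real.log n → f (Real.log n) + f (-Real.log n) = 0 := by
    intro n hn
    have h1 : R < |Real.log n| := lt_of_lt_of_le hn (le_abs_self _)
    rw [hf _ h1, hf _ (by rwa [abs_neg]), add_zero]
  rw [WeilContinuous.weilPrimeTerm_eq_sum_of_support hf, dialPrimeTerm_eq_sum p K hf,
    ← Finset.sum_sub_distrib, Finset.sum_eq_single p]
  · simp only [dvd_refl, if_true, ArithmeticFunction.vonMangoldt_apply_prime hp]
    push_cast; ring
  · intro n _ hnp
    by_cases hdvd : p ∣ n
    · by_cases hΛ : Λ n = 0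
      · simp [hΛ]
      · have hpp : IsPrimePow n := by
          by_contra hnot
          exact hΛ (ArithmeticFunction.vonMangoldt_eq_zero_iff.2 hnot)
        obtain ⟨q, k, hq, hk, rfl⟩ := (isPrimePow_nat_iff _).1 hpp
        have hpq : p = q := (Nat.prime_dvd_prime_iff_eq hp hq).1 (hp.dvd_of_dvd_pow hdvd)
        subst hpq
        have hk2 : 2 ≤ k := by
          by_contra hlt
          have hk1 : k = 1 := by omega
          subst hk1
          exact hnp (pow_one p)
        have hlogn : R < Real.log ((p ^ k : ℕ) : ℝ) := by
          have : (2 : ℝ) * Real.log p ≤ Real.log ((p ^ k : ℕ) : ℝ) := by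
            rw [Nat.cast_pow, Real.log_pow]
            have : (2 : ℝ) ≤ k := by exact_mod_cast hk2
            nlinarith [Real.log_pos hp1]
          linarith
        rw [hvan _ hlogn]; ring
    · simp [hdvd]
  · intro hnot
    rw [Finset.mem_range, not_lt] at hnot
    have hn' : Real.exp (R + 1) ≤ p := (Nat.le_ceil _).trans (by exact_mod_cast hnot)
    have hlog : R + 1 ≤ Real.log p := by rwa [Real.le_log_iff_exp_le hp0]
    rw [hvan p (by linarith)]; ring

/-- `Q_{p,K}(h) = Q_ζ(h) + (prime term of ζ − dialled prime term)(A_h)`. -/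
theorem dialQuadratic_eq (p : ℕ) (K : ℝ) (h : ℝ → ℂ) :
    dialQuadratic p K h = weilQuadratic h +
      (weilPrimeTerm (weilConv h (weilReflect h)) -
        dialPrimeTerm p K (weilConv h (weilReflect h))) := by
  unfold dialQuadratic dialFunctional weilQuadratic weilFunctional; ring

/-! ## Assembly -/

/-- **THEOREM F5-A (quantitative form), PROVED.** -/
theorem tailDialRayleighBound : TailDialRayleighBound := by
  intro p hp K b ε _hK hb hb2 hW g₁ hg hs hq
  have hlogp : 0 < Real.log p := Real.log_pos (by exact_mod_cast hp.one_lt)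
  obtain ⟨c, hc_def⟩ : ∃ c : ℝ, c = Real.log p / 2 := ⟨_, rfl⟩
  obtain ⟨σ, hσ_def⟩ : ∃ σ : ℝ, σ = (SignType.sign (1 - K) : ℝ) := ⟨_, rfl⟩
  obtain ⟨N, hN_def⟩ : ∃ N : ℝ, N = ∫ x, ‖g₁ x‖ ^ 2 := ⟨_, rfl⟩
  unfold tailTwinTest
  rw [← hc_def, ← hσ_def]
  rw [← hN_def] at hq ⊢
  have hc0 : 0 < c := by rw [hc_def]; linarith
  have hbc : b < c := by rw [hc_def]; linarith
  have hc2 : 2 * c = Real.log p := by rw [hc_def]; ring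
  have hwin : Real.log p / 2 + b = c + b := by rw [hc_def]
  rw [hwin] at hW
  -- σ ∈ {-1, 0, 1}: σ² ≤ 1 and (1 - K) σ = |1 - K|
  have hσ : σ ^ 2 ≤ 1 ∧ (1 - K) * σ = |1 - K| := by
    rcases lt_trichotomy (1 - K) 0 with h | h | h
    · rw [hσ_def, sign_neg h, abs_of_neg h]; simp
    · rw [hσ_def, h, sign_zero, abs_zero]; simp
    · rw [hσ_def, sign_pos h, abs_of_pos h]; simp
  -- the two translates and the positivity inputs
  set u : ℝ → ℂ := translate (-c) g₁ with hu_def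
  set v : ℝ → ℂ := translate c g₁ with hv_def
  have hu : IsWeilTest u := isWeilTest_translate hg _
  have hv : IsWeilTest v := isWeilTest_translate hg _
  have hus : tsupport u ⊆ Icc (-(c + b)) (c + b) :=
    (tsupport_translate_subset hs (-c)).trans (Icc_subset_Icc (by linarith) (by linarith))
  have hvs : tsupport v ⊆ Icc (-(c + b)) (c + b) :=
    (tsupport_translate_subset hs c).trans (Icc_subset_Icc (by linarith) (by linarith))
  have hQu : (weilQuadratic u).re = (weilQuadratic g₁).re := by rw [hu_def, weilQuadratic_translate]
  have hQv : (weilQuadratic v).re = (weilQuadratic g₁).re := by rw [hv_def, weilQuadratic_translate]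
  have hQ1 : 0 ≤ (weilQuadratic g₁).re :=
    hW g₁ hg (hs.trans (Icc_subset_Icc (by linarith) (by linarith)))
  have hplus : 0 ≤ (weilQuadratic (u + fun x ↦ ((σ : ℝ) : ℂ) * v x)).re :=
    hW _ (hu.add (hv.const_mul _)) (tsupport_add_mul_subset isClosed_Icc hus hvs _)
  -- parallelogram: Re Q(u - σ v) ≤ 2 Re Q(u) + 2σ² Re Q(v) ≤ 4εN
  have hQg : (weilQuadratic (twin c σ g₁)).re ≤ 4 * (ε * N) := by
    rw [twin_eq_add c σ g₁, ConnesVanSuijlekom.re_weilQuadratic_add_real_mul hu hv (-σ)]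
    rw [ConnesVanSuijlekom.re_weilQuadratic_add_real_mul hu hv σ] at hplus
    rw [hQu, hQv] at hplus ⊢
    have h1 : σ ^ 2 * (weilQuadratic g₁).re ≤ (weilQuadratic g₁).re :=
      mul_le_of_le_one_left hQ1 hσ.1
    nlinarith [hσ.1, hQ1, hq, sq_nonneg σ]
  -- the autocorrelation of the twin vanishes for |x| > 2(c + b) and equals -σN at ± log p
  have htws : tsupport (twin c σ g₁) ⊆ Icc (-(c + b)) (c + b) := tsupport_twin_subset hs hc0.le σ
  have hAs := tsupport_weilConv_weilReflect_subset (isWeilTest_twin hg c σ).2 htws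
  have hAz : ∀ x : ℝ, 2 * (c + b) < |x| →
      weilConv (twin c σ g₁) (weilReflect (twin c σ g₁)) x = 0 := by
    intro x hx
    refine eq_zero_of_tsupport_subset hAs fun hmem ↦ ?_
    simp only [mem_Icc] at hmem
    have : |x| ≤ 2 * (c + b) := abs_le.2 ⟨by linarith, by linarith⟩
    linarith
  have hA1 :
      weilConv (twin c σ g₁) (weilReflect (twin c σ g₁)) (Real.log p) = -(σ : ℂ) * (N : ℂ) := by
    rw [← hc2, hN_def]; exact weilConv_weilReflect_twin_two_mul hs hb hbc σ
  have hA2 :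
      weilConv (twin c σ g₁) (weilReflect (twin c σ g₁)) (-Real.log p) = -(σ : ℂ) * (N : ℂ) := by
    rw [← hc2, hN_def]; exact weilConv_weilReflect_twin_neg_two_mul hs hb hbc σ
  -- the dial correction
  have hdial : (dialQuadratic p K (twin c σ g₁)).re =
      (weilQuadratic (twin c σ g₁)).re - 2 * |1 - K| * (Real.log p / Real.sqrt p) * N := by
    rw [dialQuadratic_eq, weilPrimeTerm_sub_dialPrimeTerm hp K hAz (by linarith), hA1, hA2,
      Complex.add_re]
    have : ((((1 - K) * (Real.log p / Real.sqrt p) : ℝ) : ℂ) *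
        (-(σ : ℂ) * (N : ℂ) + -(σ : ℂ) * (N : ℂ))) =
        ((-(2 * ((1 - K) * σ) * (Real.log p / Real.sqrt p) * N) : ℝ) : ℂ) := by
      push_cast; ring
    rw [this, Complex.ofReal_re, hσ.2]
    ring
  rw [hdial, show |1 - K| * Real.log p / Real.sqrt p = |1 - K| * (Real.log p / Real.sqrt p) by ring]
  nlinarith [hQg]

/-- **THEOREM F5-A (dichotomy form), PROVED.** -/
theorem tailDialNegativeOrZetaNotPositive : TailDialNegativeOrZetaNotPositive :=
  tailDialNegativeOrZetaNotPositive_of_bound tailDialRayleighBound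

/-- **Corollary (the prime-deletion twins `T_p`, `K = 0`).** For any Weil test `g₁ ⊆ [-b, b]` with
`Re Q_ζ(g₁) ≤ ε‖g₁‖₂²`, `‖g₁‖₂ > 0` and `2ε < log p/√p`: either `ζ` is not Weil-positive on the
window `(log p)/2 + b`, or `Re Q_{T_p}(τ_{-log p/2} g₁ - τ_{log p/2} g₁) < 0`. -/
theorem primeDeletion_negative_or_zeta_not_positive {p : ℕ} (hp : p.Prime) {b ε : ℝ}
    (hb : 0 < b) (hb2 : 2 * b < Real.log p) {g₁ : ℝ → ℂ} (hg : IsWeilTest g₁)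
    (hs : tsupport g₁ ⊆ Icc (-b) b) (hq : (weilQuadratic g₁).re ≤ ε * ∫ x, ‖g₁ x‖ ^ 2)
    (hpos : 0 < ∫ x, ‖g₁ x‖ ^ 2) (hε : 2 * ε < Real.log p / Real.sqrt p) :
    ¬ WeilPositivityOn (Real.log p / 2 + b) ∨
      (dialQuadratic p 0 (fun x ↦ translate (-(Real.log p / 2)) g₁ x -
        translate (Real.log p / 2) g₁ x)).re < 0 := by
  have h := tailDialNegativeOrZetaNotPositive p hp 0 b ε le_rfl hb hb2 g₁ hg hs hq hpos
    (by simpa using hε)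
  have e : tailTwinTest p 0 g₁ =
      fun x ↦ translate (-(Real.log p / 2)) g₁ x - translate (Real.log p / 2) g₁ x := by
    funext x; simp [tailTwinTest, twin]
  rwa [e] at h

end Summit.RiemannHypothesis.RiemannHypothesis.Theorems.PfPersistenceF5TailTwins
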